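import Summits.BirchSwinnertonDyer.BirchSwinnertonDyer.Theorems.GenusKolyvaginAtTwoMinimalTwinBSDTwoTwinShaAnnihilation
import Summits.BirchSwinnertonDyer.BirchSwinnertonDyer.Theorems.GenusKolyvaginAtTwoMinimalTwinBSDTwoSwappedPairSandwich
import Summits.BirchSwinnertonDyer.BirchSwinnertonDyer.Theorems.GenusKolyvaginAtTwoShaCardDvdPowAtTwoRTRankQ
import Summits.BirchSwinnertonDyer.BirchSwinnertonDyer.Theorems.GenusKolyvaginAtTwoShaCardDvdPowAtTwoRTShaFiniteAtTwoRat
import Summits.BirchSwinnertonDyer.BirchSwinnertonDyer.Theorems.GenusKolyvaginAtTwoKolyvaginExclusionsOfHeegner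
import Summits.BirchSwinnertonDyer.BirchSwinnertonDyer.Theorems.GenusKolyvaginAtTwoMinimalTwinBSDTwoSwappedPairOneBitPrime
import HarnessLib

/-!
# Route `GenusKolyvaginAtTwo`, crux U₂ `MinimalTwinBSDTwo` (stmt-BirchSwinnertonDyer-22985), LINE 23 «twin_swap» v2.5, stub DIV′
# `HeegnerIndexUpperAnyTwinAtTwo` ON THE ODD `Δ < 0` CUT: **`#Ш(W_K)[2^∞] ∣ 4^{M₀}` for the rank-ONE Heegner member at EVERY exact depth `M₀`
# of `P(1)`, inside the genus budget, modulo Q2** — Kolyvagin's upper bound at `2` for the frame of the `ε = −1` member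

Seat `bsd-line-gk2-p2` g31 (PROVER seat 2/3, cell `bsd-f1-sign2`, LINE 23 holder), `--supports stmt-BirchSwinnertonDyer-22985 --as helper`.
THEOREMS ONLY (no definition, no named fact, no `sorry`).  BSD is NOT proved by any of this; neither is U₂, nor DIV′ as registered (all
frames, all budgets, the Manin factor), nor NDIV′.

WHY (LINE 23 v2.5, `Cruxes/MinimalTwinBSDTwo/Lines/twin_swap.lean`).  U₂ ⟸ WALL row 1 + DIV′ + NDIV′ + PRINT, where DIV′ is the UPPER half
`#Ш(W_K)[2^∞] · 4^{ord₂ c + ord₂ C(W)} ∣ 4^{M₀}` of the `2`-primary Gross–Zagier index relation for the rank-one member.  On the cell where `c` and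
`C(W)` are odd, DIV′ is the bare Kolyvagin bound `#Ш(W_K)[2^∞] ∣ 4^{M₀}` — in print at `l = 2` as Kolyvagin 1989 Thm. B_l (case `A = E^D`) +
Kramer's pair descent, but so far in the tree ONLY at the door-open frames `#Sel₂(W^{(d_K)}) = 1` (there `Ш(W_K)[2^∞] = 0`, gk2-p2 g23
`…SwappedPairSandwich`, gk2-p3 g28 `…SwappedPairOneBit`).  This file proves it at EVERY frame of the odd `Δ < 0` habitat cut inside the genus
budget `ord₂ C(Wd) ≤ 1` — in particular at the transposition frames where the rank-zero twin carries `Ш(W^{(d_K)})[2] ≅ (ℤ/2)²` — by LINE 19's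
three-piece architecture (PAIRCOUNT = B2Q + RANKQ + CTQ; SANDWICH) READ FOR THE SWAPPED PAIR:

* (B2Q⁻) `2^{M₀} · Ш(W^{(d_K)}/ℚ)[2^∞] = 0` — this seat's `…MinimalTwinBSDTwoTwinShaAnnihilation` (Kolyvagin's B₂ at `2` for the twin, mod Q2);
* (RANKQ⁻) §1 `natCard_selmerGroup_twin_two_dvd_four_of_genusBudget_le_one` — **`#Sel₂(W) = 2 ⟹ #Sel₂(Wd) ∣ 4`** inside the budget on `Δ < 0`
  (MR Cor. 3.4 (i) at the transposition prime, gk2-p3 g26 `cor34i_twin_heegner_transposition_unramified`, read in the other direction);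
* (CTQ / SANDWICH) gk2-p3 g27's SIGN-FREE numerical closer `natCard_sha_dvd_pow_of_pair_of_frame` with the twin `T₀ = W^{(d_K)}` AS BASE (its twist
  `T₀^{(d_K)} = D • W` is the rank-one member with `Ш[2^∞] = 0`; frame point = the twist of a rational point of infinite order; budgets = the
  route's), then the `Ш`-level twist transport `Ψ : H¹(K, T₀) ≃ H¹(K, W)` — the proof of g23's `…_of_swappedPair` with `#Sel₂(T₀) = 1` replaced by
  (B2Q⁻) + (RANKQ⁻), and `rank T₀(ℚ) = 0` from Kolyvagin's `rank W(K) ≤ 1` on the habitat (gk2-p4 g21 `mordellWeilRank_baseChange_le_one_onHabitat`).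

* §2 `finite_and_natCard_primaryComponent_sha_baseChange_two_dvd_pow_of_swappedPair_onHabitat` — the frame theorem (`rank W(ℚ) ≥ 1` displayed);
* §3 `heegnerIndexUpper_conclusion_onOddNegCut` — **DIV′'s conclusion VERBATIM** (`#Ш(W_K)[2^∞] · 2^{2(ord₂ c + ord₂ C(W))} ∣ 2^{2M₀}`) on DIV′'s own
  binders plus the cut: `Δ_W < 0`, `C(W)` odd, an odd prime of multiplicative reduction, `ρ_{W,2^n}` onto, `w(W) = −1`, `Dt.c` odd,
  `ord₂ C(Wd) ≤ 1` (the two Theorem-B field exclusions being automatic on odd Heegner fields);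
* §4 `heegnerIndexUpper_conclusion_onOddNegCut_primeFrame` — the same at every PRIME Heegner frame `d_K = −ℓ₀`, where the budget is automatic
  (`ord₂ C(Wd) = ord₂ C(W) + 1`, gk2-p3 g28 `OneBit.padicValNat_two_tamagawaProduct_twin_eq_succ_of_discr_eq_neg_prime`); modulo Q2 `KolyvaginRelationAtTwo` and GZK `rank_eq_analyticRank_of_analyticRank_le_one` (for
  `rank W(ℚ) ≥ 1` from `r_an(W) = 1`; both are route items: 24880, 19921).  The analytic binders of DIV′ (`L(W^{(d_K)},1) ≠ 0`, `2` split) are idle here.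

CENSUS READING.  On the odd `Δ < 0` cut the UPPER half DIV′ of LINE 23 is a theorem modulo Q2 + GZK at every budget-one frame; U₂ there is
`⟺ NDIV′` (the single bit «`y_K` not more `2`-divisible than `#Ш(W_K)[2^∞]` allows»).  Placement: Kolyvagin 1989 Thm. B_l at `l = 2` (case
`A = E^D`) + Kramer 1981 / Gross 1991 §5 + Mazur–Rubin 2010 Cor. 3.4 (i): COROLLARY-OF-PRINT, assembled in the kernel; nothing beyond print.

References: [Kolyvagin1989Izv] Thm. B_l; [McCallumLMS1991] §5 Thm. 5.4, Cor. 5.6; [Kramer1981] Thm. 1, §2 Prop. 3; [GrossLMS1991] §5 (5.1)–(5.3);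
[MazurRubin2010] Cor. 3.4 (i); [SilvermanAEC2009] X.4.2, X.4.14, X.5 Cor. 5.4.
-/

set_option autoImplicit false
set_option linter.dupNamespace false -- `Summit.<P>.<Sub>` repeats `BirchSwinnertonDyer` (D-0017)

noncomputable section

open scoped Classical

namespace Summit.BirchSwinnertonDyer.BirchSwinnertonDyer.Theorems.GenusExact.TwinSwap.TwinAnnihilation

open Literature.NumberTheory.EllipticCurves Literature.NumberTheory.GaloisRepresentations WeierstrassCurve NumberField
  IsDedekindDomain Field AddSubgroup Literature.NumberTheory.EllipticCurves.ModularForms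
open Summit.BirchSwinnertonDyer.Rank1Residual Literature.Barriers.BirchSwinnertonDyer
open Summit.BirchSwinnertonDyer.BirchSwinnertonDyer.Theses.GenusKolyvaginAtTwo (KolyvaginRelationAtTwo)
open Summit.BirchSwinnertonDyer.BirchSwinnertonDyer.Theorems.GenusExact.PlusDescent
open Summit.BirchSwinnertonDyer.BirchSwinnertonDyer.Theorems.GenusExact.RegularPlusDescent (archimedeanBit_sha_comap_resBaseChange
  relIndex_sha_comap_resBaseChange_le_of_arch relIndex_sha_comap_resBaseChange_twin_le_two_pow_succ_of_arch)

/-! ## §1 (RANKQ⁻) `#Sel₂(W) = 2 ⟹ #Sel₂(W^{(d_K)}) ∣ 4` inside the genus budget on `Δ < 0` -/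

/-- **(RANKQ⁻): `#Sel₂(W) = 2 ⟹ #Sel₂(Wd) ∣ 4`** for `W/ℚ` globally minimal with `Δ_W < 0`, `C(W)` odd, `K` imaginary quadratic with odd `d_K`, Heegner
for `N_W`, and an elliptic model `Wd ≅ W^{(d_K)}` with `ord₂ C(Wd) ≤ 1`: the budget is exactly one transposition prime `q₀ ∣ d_K` with all other
primes of `d_K` silent (gk2-p5 g20 `exists_transposition_prime_of_padicValNat_two_tamagawaProduct_twin_eq_one`), and MR Cor. 3.4 (i) there
(gk2-p3 g26 `cor34i_twin_heegner_transposition_unramified`) gives `#Sel₂(Wd) = 2·#Sel₂(W) = 4` (strict) or `#Sel₂(W) = 2·#Sel₂(Wd)`, i.e.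
`#Sel₂(Wd) = 1` (not strict).  UNCONDITIONAL.  [cite: MazurRubin2010, Cor. 3.4 (i)] [cite: Kramer1981, §2 Prop. 3, Thm. 1] -/
theorem natCard_selmerGroup_twin_two_dvd_four_of_genusBudget_le_one (W : WeierstrassCurve ℚ) [W.IsElliptic] [W.IsGloballyMinimal]
    {K : Type} [Field K] [NumberField K]
    (hΔ : W.Δ < 0) (hTam : Odd W.tamagawaProduct) (hK : IsImaginaryQuadratic K) (hodd : Odd (NumberField.discr K))
    (hH : SatisfiesHeegnerHypothesis (W.conductorNorm ℤ) K)
    (Wd : WeierstrassCurve ℚ) [Wd.IsElliptic] (hWd : ∃ C : VariableChange ℚ, C • W.quadraticTwist (NumberField.discr K : ℚ) = Wd)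
    (hle : padicValNat 2 Wd.tamagawaProduct ≤ 1) (hSel : Nat.card (W.selmerGroup 2) = 2) :
    Nat.card (Wd.selmerGroup 2) ∣ 4 := by
  obtain ⟨Cd, hCd⟩ := hWd
  have hB : padicValNat 2 Wd.tamagawaProduct = 1 := by
    obtain ⟨k, hk⟩ := odd_padicValNat_two_tamagawaProduct_twin_of_Δ_neg W hK hodd hH hTam hΔ Cd hCd
    omega
  obtain ⟨q₀, hq₀, hq₀d, hq₀2, hT⟩ :=
    GenusKolyTwin.exists_transposition_prime_of_padicValNat_two_tamagawaProduct_twin_eq_one W hK hodd hH hTam Cd hCd hB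
  obtain ⟨hup, hdown⟩ := cor34i_twin_heegner_transposition_unramified W hΔ hK hodd hH hq₀d hq₀2 hT Wd ⟨Cd, hCd⟩
  by_cases hs : W.selmerGroup 2 ≤ MazurRubin2010.strictLocalKer W ℚ_[q₀] 2
  · have h := hup hs
    rw [hSel] at h
    exact ⟨1, by omega⟩
  · have h := hdown hs
    rw [hSel] at h
    exact ⟨4, by omega⟩

/-! ## §2 The swapped pair sandwich WITH EXPONENT: `#Ш(W_K)[2^∞] ∣ 4^{M₀}` on the odd `Δ < 0` habitat cut -/

/-- **THE SWAPPED PAIR SANDWICH WITH EXPONENT (U_T's count for the `ε = −1` member): `#Ш(W_K)[2^∞] ∣ 4^{M₀}`.**  Frame: `W/ℚ` globally minimal,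
non-CM, `C(W)` odd, an odd prime `v` of multiplicative reduction, `Δ_W < 0`, `ρ_{W,2^n}` onto for all `n ≥ 1`; `K` imaginary quadratic, `d_K` odd
`≠ −3`, Heegner for `N_W`, `d_K·(−|Δ|)`, `d_K·(−2|Δ|)` non-squares; `(Dt, β, ι)`, a conductor-`1` datum `d₁` with `2^{M₀+1} ∤ P(1)` in `W(K[1])`;
`w(W) = −1`; `rank W(ℚ) ≥ 1` and `#Sel₂(W) = 2`; an elliptic model `Wd = Cd • W^{(d_K)}` with `ord₂ C(Wd) ≤ 1`.  Then `Ш(W_K)[2^∞]` is finite and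
**`#Ш(W_K)[2^∞] ∣ 2^{2M₀}`**.  Proof = g23's `finite_and_natCard_primaryComponent_sha_baseChange_two_eq_one_of_swappedPair` with the base
`T₀ = W^{(d_K)}` now of `Ш`-exponent `2^{M₀}` ((B2Q⁻) `two_pow_M0_smul_eq_zero_of_mem_sha_twist_rat_onHabitat`) and `2`-rank `≤ 2` ((RANKQ⁻) §1),
`rank T₀(ℚ) = 0` from `rank W(K) ≤ 1` (`mordellWeilRank_baseChange_le_one_onHabitat`) and `rank W(ℚ) = 1`, `Ш(T₀/ℚ)[2^∞]` finite
(`finite_primaryComponent_sha_twin_two_onHabitat`); then gk2-p3 g27's sign-free closer and the twist transport `Ψ`.  Modulo Q2 only.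
[cite: Kolyvagin1989Izv, Thm. B_l] [cite: McCallumLMS1991, §5 Thm. 5.4, Cor. 5.6] [cite: Kramer1981, Thm. 1] [cite: GrossLMS1991, §5 (5.1)–(5.3)]
[cite: MazurRubin2010, Cor. 3.4 (i)] [cite: SilvermanAEC2009, X.4.14, X.5 Cor. 5.4] -/
theorem finite_and_natCard_primaryComponent_sha_baseChange_two_dvd_pow_of_swappedPair_onHabitat (hQ2 : KolyvaginRelationAtTwo)
    (W : WeierstrassCurve ℚ) [W.IsElliptic] [W.IsGloballyMinimal] [NeZero (W.conductorNorm ℤ)] (hcm : ¬ W.HasCM)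
    (hT : Odd W.tamagawaProduct) (v : HeightOneSpectrum (𝓞 ℚ)) (h2v : ((2 : ℕ) : 𝓞 ℚ) ∉ v.asIdeal)
    (hNv : ((W.conductorNorm ℤ : ℕ) : 𝓞 ℚ) ∈ v.asIdeal) (hmult : W.HasMultiplicativeReductionAt v) (hneg : W.Δ < 0)
    (K : Type) [Field K] [NumberField K] (hIQ : IsImaginaryQuadratic K) (hodd : Odd (NumberField.discr K))
    (h3 : NumberField.discr K ≠ -3) (hHe : SatisfiesHeegnerHypothesis (W.conductorNorm ℤ) K)
    (hsq1 : ¬ IsSquare ((NumberField.discr K : ℚ) * -|W.Δ|)) (hsq2 : ¬ IsSquare ((NumberField.discr K : ℚ) * (-(2 * |W.Δ|))))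
    (hρ : ∀ n : ℕ, 0 < n → W.HasSurjectiveModNGaloisRep ((2 : ℤ) ^ n))
    (Dt : ModularParametrizationData W (W.conductorNorm ℤ)) (β : ℤ) (ι : K →+* ℂ) (d₁ : KolyvaginHeegnerData Dt β ι 1) (M₀ : ℕ)
    (hndiv : ¬ ∃ Q : (W.baseChange (ringClassField K ι 1)).toAffine.Point, ((2 ^ (M₀ + 1) : ℕ) : ℤ) • Q = d₁.derivedPoint)
    (hw : W.rootNumber = -1) (hrk : 1 ≤ W.mordellWeilRank) (hSel : Nat.card (W.selmerGroup 2) = 2)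
    {Wd : WeierstrassCurve ℚ} [Wd.IsElliptic] (Cd : VariableChange ℚ) (hWd : Cd • W.quadraticTwist (NumberField.discr K : ℚ) = Wd)
    (hbudget : padicValNat 2 Wd.tamagawaProduct ≤ 1) :
    Finite (AddCommGroup.primaryComponent (↥(W.baseChange K).sha) 2) ∧
      Nat.card (AddCommGroup.primaryComponent (↥(W.baseChange K).sha) 2) ∣ 2 ^ (2 * M₀) := by
  haveI : Fact (Nat.Prime 2) := ⟨Nat.prime_two⟩
  haveI : NeZero (2 : ℚ) := ⟨two_ne_zero⟩
  have h2 : Module.finrank ℚ K = 2 := hIQ.1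
  have hdK : (NumberField.discr K : ℚ) ≠ 0 := by exact_mod_cast NumberField.discr_ne_zero K
  haveI hT₀ell : (W.quadraticTwist (NumberField.discr K : ℚ)).IsElliptic := W.isElliptic_quadraticTwist hdK
  haveI hX'ell : ((W.quadraticTwist (NumberField.discr K : ℚ)).quadraticTwist (NumberField.discr K : ℚ)).IsElliptic :=
    (W.quadraticTwist (NumberField.discr K : ℚ)).isElliptic_quadraticTwist hdK
  haveI hT₀Kell : ((W.quadraticTwist (NumberField.discr K : ℚ)).baseChange K).IsElliptic :=
    inferInstanceAs (((W.quadraticTwist (NumberField.discr K : ℚ)).map (algebraMap ℚ K)).IsElliptic)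
  haveI hEKell : (W.baseChange K).IsElliptic := inferInstanceAs ((W.map (algebraMap ℚ K)).IsElliptic)
  -- `X' = T₀^(d_K) = D • W`, `Aut(K/ℚ) = {1, τ}`, `θ = √d_K`
  obtain ⟨D, hD⟩ := exists_quadraticTwist_quadraticTwist_eq_smul W hdK
  obtain ⟨τ, θ, hτ1, hθQ, hθ2, hτθ, -⟩ := exists_gal_ne_one_sqrt_discr K h2
  -- ### (a) the rank-one member: `rank W(ℚ) = 1`, a rational point of infinite order, `#Sel₂(X') = 2`, `Ш(X'/ℚ)[2^∞] = 0`
  obtain ⟨hrkW1, -, -⟩ := rank_eq_one_and_sha_primary_eq_zero_of_natCard_selmerGroup_eq_two W hSel hrk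
  obtain ⟨Q, hQ⟩ := exists_not_isOfFinAddOrder_of_one_le_mordellWeilRank W hrk
  have hSelX : Nat.card (((W.quadraticTwist (NumberField.discr K : ℚ)).quadraticTwist (NumberField.discr K : ℚ)).selmerGroup 2) = 2 := by
    have h := natCard_selmerGroup_smul W D (n := 2) two_ne_zero
    simp only [Nat.cast_ofNat] at h
    rw [← hD] at h
    exact h.trans hSel
  have hrkX : ((W.quadraticTwist (NumberField.discr K : ℚ)).quadraticTwist (NumberField.discr K : ℚ)).mordellWeilRank = 1 := by
    have h : (D • W).mordellWeilRank = W.mordellWeilRank := mordellWeilRank_variableChange_holds W D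
    rw [← hD] at h
    rw [h, hrkW1]
  obtain ⟨-, -, hT0⟩ := rank_eq_one_and_sha_primary_eq_zero_of_natCard_selmerGroup_eq_two
    ((W.quadraticTwist (NumberField.discr K : ℚ)).quadraticTwist (NumberField.discr K : ℚ)) hSelX (by rw [hrkX])
  -- ### (b) the base `T₀`: rank `0` (Kolyvagin's `rank W(K) ≤ 1` on the habitat), `Ш(T₀/ℚ)[2^∞]` finite of exponent `2^{M₀}` (B2Q⁻), `2`-rank `≤ 2` (RANKQ⁻)
  haveI : Module.Finite ℤ (W.baseChange K).toAffine.Point := (W.baseChange K).module_finite_point_holds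
  have hrkK : (W.baseChange K).mordellWeilRank ≤ 1 :=
    mordellWeilRank_baseChange_le_one_onHabitat hQ2 W hcm hT v h2v hNv hmult hneg K hIQ hodd h3 hHe hsq1 hsq2 hρ Dt β ι d₁ M₀ hndiv
  have hrkT0 : (W.quadraticTwist (NumberField.discr K : ℚ)).mordellWeilRank = 0 := by
    have hsum := W.mordellWeilRank_baseChange_of_finrank_eq_two_of_finite K h2
    rw [hrkW1] at hsum
    omega
  haveI hfinT : Finite (AddCommGroup.primaryComponent (↥(W.quadraticTwist (NumberField.discr K : ℚ)).sha) 2) :=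
    finite_primaryComponent_sha_twin_two_onHabitat hQ2 W hcm hT v h2v hNv hmult hneg K hIQ hodd h3 hHe hsq1 hsq2 hρ Dt β ι d₁ M₀ hndiv
      (W.quadraticTwist (NumberField.discr K : ℚ)) ⟨1, one_smul _ _⟩
  have hexp : ∀ a ∈ AddCommGroup.primaryComponent (↥(W.quadraticTwist (NumberField.discr K : ℚ)).sha) 2, 2 ^ M₀ • a = 0 := by
    intro a ha
    obtain ⟨k, hk⟩ := (AddCommGroup.mem_primaryComponent).1 ha
    have hka : ((2 ^ k : ℕ) : ℤ) • (a : (W.quadraticTwist (NumberField.discr K : ℚ)).galH1) = 0 := by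
      rw [natCast_zsmul, ← AddSubgroupClass.coe_nsmul, hk, ZeroMemClass.coe_zero]
    have h0 := two_pow_M0_smul_eq_zero_of_mem_sha_twist_rat_onHabitat hQ2 W hcm hT v h2v hNv hmult hneg K hIQ hodd h3 hHe hsq1 hsq2 hρ Dt β ι
      d₁ M₀ hndiv hw k (a : (W.quadraticTwist (NumberField.discr K : ℚ)).galH1) a.2 hka
    apply Subtype.ext
    rw [AddSubgroupClass.coe_nsmul, ZeroMemClass.coe_zero, ← natCast_zsmul]
    exact h0
  -- `E(K)[2] = 0` from `ρ̄_{E,2}` onto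
  have hs2 : W.HasSurjectiveModNGaloisRep 2 := by simpa using hρ 1 one_pos
  have h2K : ∀ P : (W.baseChange K).toAffine.Point, (2 : ℤ) • P = 0 → P = 0 := fun P hP ↦
    EigenClassesFinite.forall_zsmul_two_pow_baseChange_eq_zero_of_hasSurjectiveModNGaloisRep_two W K h2 hs2 1 P (by simpa using hP)
  -- ### (c) the frame of `T₀ ⊗ K`: no `2`-torsion, rank `≤ 1`, the anti-invariant point of infinite order
  have hrkTK : ((W.quadraticTwist (NumberField.discr K : ℚ)).baseChange K).mordellWeilRank ≤ 1 := by
    haveI : Module.Finite ℤ ((W.quadraticTwist (NumberField.discr K : ℚ)).baseChange K).toAffine.Point :=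
      ((W.quadraticTwist (NumberField.discr K : ℚ)).baseChange K).module_finite_point_holds
    rw [(W.quadraticTwist (NumberField.discr K : ℚ)).mordellWeilRank_baseChange_of_finrank_eq_two_of_finite K h2, hrkT0, hrkX]
  obtain ⟨C₁, hC₁⟩ := W.exists_variableChange_quadraticTwist_one
  have h2torsT : ∀ P : ((W.quadraticTwist (NumberField.discr K : ℚ)).baseChange K).toAffine.Point, (2 : ℤ) • P = 0 → P = 0 := by
    intro P hP
    let eK : ((W.quadraticTwist (NumberField.discr K : ℚ)).baseChange K).toAffine.Point ≃+ (W.baseChange K).toAffine.Point :=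
      ((VariableChange.pointEquiv ((W.quadraticTwist (NumberField.discr K : ℚ)).baseChange K) (twistUntwist hθQ)).trans
        (Affine.Point.congrEquiv (twistUntwist_smul_baseChange W hθQ hθ2))).trans
        ((Affine.Point.congrEquiv (congrArg (fun V : WeierstrassCurve ℚ ↦ V.baseChange K) hC₁.symm)).trans
          (VariableChange.pointEquivBaseChange W C₁ K).symm)
    have h := h2K (eK P) (by rw [← map_zsmul, hP, map_zero])
    exact eK.injective (h.trans (map_zero eK).symm)
  -- the frame point: the twist of `Q`, anti-invariant of infinite order
  have hτθ' : (τ : K →ₐ[ℚ] K) θ = -θ := hτθ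
  obtain ⟨y, hy_inf, hyanti⟩ := exists_antiInvariant_twist_point_of_not_isOfFinAddOrder W hθQ hθ2 hdK hτθ' hQ
  have hanti : IsOfFinAddOrder (Affine.Point.map (W' := W.quadraticTwist (NumberField.discr K : ℚ)) (τ : K →ₐ[ℚ] K) y + y) := by
    rw [hyanti, neg_add_cancel]
    exact IsOfFinAddOrder.zero
  haveI : Module.Finite ℤ ((W.quadraticTwist (NumberField.discr K : ℚ)).baseChange K).toAffine.Point :=
    ((W.quadraticTwist (NumberField.discr K : ℚ)).baseChange K).module_finite_point_holds
  obtain ⟨M, -, hndiv'⟩ := exists_pow_smul_eq_and_not_of_not_isOfFinAddOrder Nat.prime_two hy_inf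
  have hndiv : ∀ Q' : ((W.quadraticTwist (NumberField.discr K : ℚ)).baseChange K).toAffine.Point, ((2 ^ (M + 1) : ℕ) : ℤ) • Q' ≠ y :=
    fun Q' h ↦ hndiv' ⟨Q', h⟩
  -- ### (d) the two budgets: twin side for `T₀` (the route's), model-free core for `X' = D • W`
  have hgoodX : ∀ p : ℕ, p.Prime → ¬ (p : ℤ) ∣ NumberField.discr K → ((Ideal.span {(p : ℤ)}).primesOver (𝓞 K)).ncard ≠ 2 →
      ((W.quadraticTwist (NumberField.discr K : ℚ)).quadraticTwist (NumberField.discr K : ℚ)).HasGoodReductionAt (Matsuno2009.primePlace p) := by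
    intro p hp _ hns
    rw [hD]
    exact (hasGoodReductionAt_smul_iff_holds (Matsuno2009.primePlace p) W D).mpr
      (hasGoodReductionAt_primePlace_of_ncard_ne_two W K hHe hp hns)
  have hprodX : ∏ p ∈ (NumberField.discr K).natAbs.primeFactors,
      Nat.card {P : (((W.quadraticTwist (NumberField.discr K : ℚ)).quadraticTwist (NumberField.discr K : ℚ)).baseChange
        ((Matsuno2009.primePlace p).adicCompletion ℚ)).toAffine.Point // 2 • P = 0} = 2 ^ padicValNat 2 Wd.tamagawaProduct := by
    rw [← prod_ncard_roots_add_one_eq_two_pow_padicValNat_tamagawaProduct_twin W hIQ hodd hHe hT Cd hWd]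
    refine Finset.prod_congr rfl fun p hp ↦ ?_
    obtain ⟨hpr, hpdvd, -⟩ := Nat.mem_primeFactors.mp hp
    have hpd : (p : ℤ) ∣ NumberField.discr K := Int.natCast_dvd.mpr hpdvd
    have hp2 : p ≠ 2 := by
      rintro rfl
      obtain ⟨r, hr⟩ := hodd
      omega
    haveI := Fact.mk hpr
    rw [natCard_twoTorsion_baseChange_eq_of_smul D hD ((Matsuno2009.primePlace p).adicCompletion ℚ),
      natCard_twoTorsion_adicCompletion_eq_padic W (Matsuno2009.primePlace p) (Matsuno2009.natCast_mem_primePlace hpr)]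
    exact GenusKolyTwin.natCard_twoTorsion_padic_eq W hp2
      (not_dvd_minimalDiscriminantInt_of_dvd_discr_of_heegner W K hIQ.1 hHe hpr hp2 hpd)
  have heqT : padicValNat 2 (W.quadraticTwist (NumberField.discr K : ℚ)).tamagawaProduct = padicValNat 2 Wd.tamagawaProduct := by
    have h1 := prod_ncard_roots_add_one_eq_two_pow_padicValNat_tamagawaProduct_twin W hIQ hodd hHe hT
      (Wd := W.quadraticTwist (NumberField.discr K : ℚ)) 1 (one_smul _ _)
    have h2' := prod_ncard_roots_add_one_eq_two_pow_padicValNat_tamagawaProduct_twin W hIQ hodd hHe hT Cd hWd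
    exact Nat.pow_right_injective le_rfl (h1.symm.trans h2')
  -- (RANKQ⁻) for the base: `#Sel₂(T₀) ∣ 4`, hence `#Ш(T₀/ℚ)[2] ≤ 4`
  have hSelT : Nat.card ((W.quadraticTwist (NumberField.discr K : ℚ)).selmerGroup 2) ∣ 4 :=
    natCard_selmerGroup_twin_two_dvd_four_of_genusBudget_le_one W hneg hT hIQ hodd hHe (W.quadraticTwist (NumberField.discr K : ℚ))
      ⟨1, one_smul _ _⟩ (by rw [heqT]; exact hbudget) hSel
  have h4 : Nat.card (AddSubgroup.torsionBy (↥(W.quadraticTwist (NumberField.discr K : ℚ)).sha) ((2 : ℕ) : ℤ)) ≤ 4 := by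
    have hsha := natCard_sha_torsionBy_dvd_natCard_selmerGroup (W.quadraticTwist (NumberField.discr K : ℚ)) (n := 2) two_ne_zero
    exact Nat.le_of_dvd (by norm_num) (hsha.trans hSelT)
  have hbud :
      ((W.quadraticTwist (NumberField.discr K : ℚ)).sha).relIndex
          ((((W.quadraticTwist (NumberField.discr K : ℚ)).baseChange K).sha).comap
            (resBaseChange (W.quadraticTwist (NumberField.discr K : ℚ)) K)) ≠ 0 ∧
      (((W.quadraticTwist (NumberField.discr K : ℚ)).quadraticTwist (NumberField.discr K : ℚ)).sha).relIndex
          (((((W.quadraticTwist (NumberField.discr K : ℚ)).quadraticTwist (NumberField.discr K : ℚ)).baseChange K).sha).comap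
            (resBaseChange ((W.quadraticTwist (NumberField.discr K : ℚ)).quadraticTwist (NumberField.discr K : ℚ)) K)) ≠ 0 ∧
      ((W.quadraticTwist (NumberField.discr K : ℚ)).sha).relIndex
          ((((W.quadraticTwist (NumberField.discr K : ℚ)).baseChange K).sha).comap
            (resBaseChange (W.quadraticTwist (NumberField.discr K : ℚ)) K)) *
        (((W.quadraticTwist (NumberField.discr K : ℚ)).quadraticTwist (NumberField.discr K : ℚ)).sha).relIndex
          (((((W.quadraticTwist (NumberField.discr K : ℚ)).quadraticTwist (NumberField.discr K : ℚ)).baseChange K).sha).comap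
            (resBaseChange ((W.quadraticTwist (NumberField.discr K : ℚ)).quadraticTwist (NumberField.discr K : ℚ)) K)) ≤ 4 := by
    obtain ⟨hneT, hleT⟩ := relIndex_sha_comap_resBaseChange_twin_le_two_pow W (K := K) hneg hIQ hodd hHe hT
      (Wd := W.quadraticTwist (NumberField.discr K : ℚ)) 1 (one_smul _ _)
    rw [heqT] at hleT
    have hneX := relIndex_sha_relaxed_ne_zero ((W.quadraticTwist (NumberField.discr K : ℚ)).quadraticTwist (NumberField.discr K : ℚ))
      K h2 hodd hgoodX
    have hleX := relIndex_sha_relaxed_le_prod_natCard_twoTorsion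
      ((W.quadraticTwist (NumberField.discr K : ℚ)).quadraticTwist (NumberField.discr K : ℚ)) K h2 hodd hgoodX
    have hΔX : ((W.quadraticTwist (NumberField.discr K : ℚ)).quadraticTwist (NumberField.discr K : ℚ)).Δ < 0 := by
      rw [hD, variableChange_Δ]
      have h1 : (0 : ℚ) < ((D.u⁻¹ : ℚˣ) : ℚ) ^ 12 := Even.pow_pos (by norm_num) (Units.ne_zero _)
      nlinarith [mul_pos h1 (neg_pos.mpr hneg)]
    rw [comap_resBaseChange_sha_inf_iInf_eq_of_Δ_neg _ K hΔX] at hneX hleX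
    rw [hprodX] at hleX
    refine ⟨hneT, hneX, ?_⟩
    have h22 : 2 ^ padicValNat 2 Wd.tamagawaProduct ≤ 2 :=
      calc 2 ^ padicValNat 2 Wd.tamagawaProduct ≤ 2 ^ 1 := Nat.pow_le_pow_right (by norm_num) hbudget
        _ = 2 := pow_one 2
    calc _ ≤ 2 ^ padicValNat 2 Wd.tamagawaProduct * 2 ^ padicValNat 2 Wd.tamagawaProduct := Nat.mul_le_mul hleT hleX
      _ ≤ 2 * 2 := Nat.mul_le_mul h22 h22
  obtain ⟨hne, hneT', hbud4⟩ := hbud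
  -- ### (e) the sandwich for the base `T₀`: `#Ш(T₀/K)[2^∞] ∣ 4^{M₀}`
  obtain ⟨hfinTK, hdvd⟩ := natCard_sha_dvd_pow_of_pair_of_frame (W.quadraticTwist (NumberField.discr K : ℚ)) K hIQ hτ1 h2torsT
    hrkTK y M hndiv hanti hT0 hne hneT' hbud4 hexp h4
  -- ### (f) transport along `Ψ : H¹(K, T₀) ≃ H¹(K, E)`
  haveI := hfinTK
  obtain ⟨Ψ, hΨ, -, -, -⟩ := exists_galH1_twistTransport W K h2 hθQ hθ2 τ hτ1
  obtain ⟨hfin, hcard⟩ := finite_and_natCard_primaryComponent_eq_of_addEquiv Ψ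
    (((W.quadraticTwist (NumberField.discr K : ℚ)).baseChange K).sha) ((W.baseChange K).sha) hΨ 2
  refine ⟨hfin, ?_⟩
  rw [hcard]
  exact hdvd


/-! ## §3 DIV′'s conclusion verbatim on the odd `Δ < 0` cut -/

/-- **DIV′ ON THE ODD `Δ < 0` CUT (LINE 23 v2.5 stub `stub_heegnerIndexUpper`, conclusion VERBATIM):** on the binders of
`TwinSwapV25.HeegnerIndexUpperAnyTwinAtTwo` (the `2`-Selmer-minimal rank-one member `W`, an odd Heegner frame `K` with `2` split, a globally minimal
twin model `Wd`, `L(W^{(d_K)},1) ≠ 0`, a frame `(Dt, β, ι, d₁)` and ANY exact `2`-depth `M₀` of `P(1)`) PLUS the cut — `Δ_W < 0`, `C(W)` odd, an odd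
prime `v` of multiplicative reduction, `ρ_{W,2^n}` onto (`n ≥ 1`), `w(W) = −1`, `Dt.c` odd, `ord₂ C(Wd) ≤ 1` (Kolyvagin's two field
exclusions `d_K·(−|Δ|)`, `d_K·(−2|Δ|) ∉ ℚ²` are automatic here, gk2-p2 g7 `kolyvaginExclusions_of_odd_of_satisfiesHeegnerHypothesis`) — and the two
named route inputs Q2 (`KolyvaginRelationAtTwo`, item 24880) and GZK (`rank_eq_analyticRank_of_analyticRank_le_one`,
item 19921): **`#Ш(W_K)[2^∞] · 2^{2(ord₂ c + ord₂ C(W))} ∣ 2^{2M₀}`**.  With `c`, `C(W)` odd the factor is `1` and this is §2.  The analytic binders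
`hLv`, `h2K` and the lower divisibility `2^{M₀} ∣ P(1)` are idle.  CONDITIONAL on Q2 and GZK; closes nothing by itself; BSD is NOT proved.
[cite: Kolyvagin1989Izv, Thm. B_l] [cite: McCallumLMS1991, §5 Cor. 5.6] [cite: Kramer1981, Thm. 1] [cite: MazurRubin2010, Cor. 3.4 (i)] -/
theorem heegnerIndexUpper_conclusion_onOddNegCut (hQ2 : KolyvaginRelationAtTwo) (hGZK : rank_eq_analyticRank_of_analyticRank_le_one)
    (W : WeierstrassCurve ℚ) [W.IsElliptic] [W.IsGloballyMinimal] [NeZero (W.conductorNorm ℤ)]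
    (hcm : ¬ W.HasCM) (hr : W.analyticRank = 1) (hSel : Nat.card (W.selmerGroup 2) = 2)
    (K : Type) [Field K] [NumberField K] (hK : IsImaginaryQuadratic K)
    (hodd : Odd (NumberField.discr K)) (h3 : NumberField.discr K ≠ -3) (hH : SatisfiesHeegnerHypothesis (W.conductorNorm ℤ) K)
    (_h2K : ((Ideal.span {(2 : ℤ)}).primesOver (𝓞 K)).ncard = 2)
    (Wd : WeierstrassCurve ℚ) [Wd.IsElliptic] [Wd.IsGloballyMinimal]
    (hWd : ∃ C : VariableChange ℚ, C • W.quadraticTwist (NumberField.discr K : ℚ) = Wd)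
    (_hLv : (W.quadraticTwist (NumberField.discr K : ℚ)).entireLFunction 1 ≠ 0)
    (Dt : ModularParametrizationData W (W.conductorNorm ℤ)) (β : ℤ) (ι : K →+* ℂ) (d₁ : KolyvaginHeegnerData Dt β ι 1) (M₀ : ℕ)
    (_hdiv : ∃ Q : (W.baseChange (ringClassField K ι 1)).toAffine.Point, ((2 ^ M₀ : ℕ) : ℤ) • Q = d₁.derivedPoint)
    (hndiv : ¬ ∃ Q : (W.baseChange (ringClassField K ι 1)).toAffine.Point, ((2 ^ (M₀ + 1) : ℕ) : ℤ) • Q = d₁.derivedPoint)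
    -- the cut
    (hneg : W.Δ < 0) (hT : Odd W.tamagawaProduct) (v : HeightOneSpectrum (𝓞 ℚ)) (h2v : ((2 : ℕ) : 𝓞 ℚ) ∉ v.asIdeal)
    (hNv : ((W.conductorNorm ℤ : ℕ) : 𝓞 ℚ) ∈ v.asIdeal) (hmult : W.HasMultiplicativeReductionAt v)
    (hρ : ∀ n : ℕ, 0 < n → W.HasSurjectiveModNGaloisRep ((2 : ℤ) ^ n))
    (hw : W.rootNumber = -1) (hc : Odd Dt.c) (hbudget : padicValNat 2 Wd.tamagawaProduct ≤ 1) :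
    Nat.card (AddCommGroup.primaryComponent (W.baseChange K).sha 2) *
        2 ^ (2 * (padicValInt 2 Dt.c + padicValNat 2 W.tamagawaProduct)) ∣ 2 ^ (2 * M₀) := by
  haveI : Fact (Nat.Prime 2) := ⟨Nat.prime_two⟩
  -- the Manin / Tamagawa factor is `1` on the odd cell
  have hc2 : padicValInt 2 Dt.c = 0 :=
    padicValInt.eq_zero_of_not_dvd fun h ↦ (Int.not_even_iff_odd.mpr hc) (even_iff_two_dvd.mpr (by exact_mod_cast h))
  have hC2 : padicValNat 2 W.tamagawaProduct = 0 :=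
    padicValNat.eq_zero_of_not_dvd fun h ↦ (Nat.not_even_iff_odd.mpr hT) (even_iff_two_dvd.mpr h)
  rw [hc2, hC2, add_zero, mul_zero, pow_zero, mul_one]
  -- Kolyvagin's two field exclusions are automatic on a Heegner field with odd `d_K` (gk2-p2 g7)
  obtain ⟨hsq1, hsq2⟩ := kolyvaginExclusions_of_odd_of_satisfiesHeegnerHypothesis W hK hodd hH
  -- `rank W(ℚ) = r_an(W) = 1` (GZK), then §2
  have hrk : 1 ≤ W.mordellWeilRank := by
    rw [(hGZK W (le_of_eq hr)).1, hr]
  obtain ⟨Cd, hCd⟩ := hWd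
  exact (finite_and_natCard_primaryComponent_sha_baseChange_two_dvd_pow_of_swappedPair_onHabitat hQ2 W hcm hT v h2v hNv hmult hneg K hK hodd
    h3 hH hsq1 hsq2 hρ Dt β ι d₁ M₀ hndiv hw hrk hSel Cd hCd hbudget).2

/-! ## §4 Prime frames: the budget is automatic on `Δ < 0` -/

/-- **DIV′ ON THE ODD `Δ < 0` CUT AT EVERY PRIME HEEGNER FRAME `K = ℚ(√−ℓ₀)`, NO budget hypothesis**: on `Δ_W < 0` with `C(W)` odd the single
ramified prime of a prime discriminant `d_K = −ℓ₀` is of TRANSPOSITION type, `ord₂ C(Wd) = ord₂ C(W) + 1 = 1` (gk2-p3 g28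
`OneBit.padicValNat_two_tamagawaProduct_twin_eq_succ_of_discr_eq_neg_prime`), so §3 applies: **`#Ш(W_K)[2^∞] · 2^{2(ord₂ c + ord₂ C(W))} ∣ 2^{2M₀}`**
for every frame `(Dt, β, ι, d₁)` with `Dt.c` odd and every exact depth `M₀`, modulo Q2 and GZK.  These are ALL the odd prime Heegner frames of a
`Δ < 0` curve on the cut — the door-open ones (`#Sel₂(Wd) = 1`, where this was known: `Ш(W_K)[2^∞] = 0`) AND the ones with `Ш(Wd)[2] ≅ (ℤ/2)²`
(`#Sel₂(Wd) = 4`), where it is new.  CONDITIONAL on Q2 and GZK; closes nothing; BSD is NOT proved.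
[cite: Kolyvagin1989Izv, Thm. B_l] [cite: Kramer1981, §2 Prop. 3] [cite: MazurRubin2010, Cor. 3.4 (i)] -/
theorem heegnerIndexUpper_conclusion_onOddNegCut_primeFrame (hQ2 : KolyvaginRelationAtTwo)
    (hGZK : rank_eq_analyticRank_of_analyticRank_le_one)
    (W : WeierstrassCurve ℚ) [W.IsElliptic] [W.IsGloballyMinimal] [NeZero (W.conductorNorm ℤ)]
    (hcm : ¬ W.HasCM) (hr : W.analyticRank = 1) (hSel : Nat.card (W.selmerGroup 2) = 2)
    (K : Type) [Field K] [NumberField K] (hK : IsImaginaryQuadratic K)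
    (hodd : Odd (NumberField.discr K)) (h3 : NumberField.discr K ≠ -3) (hH : SatisfiesHeegnerHypothesis (W.conductorNorm ℤ) K)
    {ℓ₀ : ℕ} (hℓ₀ : ℓ₀.Prime) (hdℓ₀ : NumberField.discr K = -(ℓ₀ : ℤ))
    (Wd : WeierstrassCurve ℚ) [Wd.IsElliptic] [Wd.IsGloballyMinimal]
    (hWd : ∃ C : VariableChange ℚ, C • W.quadraticTwist (NumberField.discr K : ℚ) = Wd)
    (Dt : ModularParametrizationData W (W.conductorNorm ℤ)) (β : ℤ) (ι : K →+* ℂ) (d₁ : KolyvaginHeegnerData Dt β ι 1) (M₀ : ℕ)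
    (hndiv : ¬ ∃ Q : (W.baseChange (ringClassField K ι 1)).toAffine.Point, ((2 ^ (M₀ + 1) : ℕ) : ℤ) • Q = d₁.derivedPoint)
    -- the cut
    (hneg : W.Δ < 0) (hT : Odd W.tamagawaProduct) (v : HeightOneSpectrum (𝓞 ℚ)) (h2v : ((2 : ℕ) : 𝓞 ℚ) ∉ v.asIdeal)
    (hNv : ((W.conductorNorm ℤ : ℕ) : 𝓞 ℚ) ∈ v.asIdeal) (hmult : W.HasMultiplicativeReductionAt v)
    (hρ : ∀ n : ℕ, 0 < n → W.HasSurjectiveModNGaloisRep ((2 : ℤ) ^ n))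
    (hw : W.rootNumber = -1) (hc : Odd Dt.c) :
    Nat.card (AddCommGroup.primaryComponent (W.baseChange K).sha 2) *
        2 ^ (2 * (padicValInt 2 Dt.c + padicValNat 2 W.tamagawaProduct)) ∣ 2 ^ (2 * M₀) := by
  haveI : Fact (Nat.Prime 2) := ⟨Nat.prime_two⟩
  obtain ⟨Cd, hCd⟩ := hWd
  have hc2 : padicValInt 2 Dt.c = 0 :=
    padicValInt.eq_zero_of_not_dvd fun h ↦ (Int.not_even_iff_odd.mpr hc) (even_iff_two_dvd.mpr (by exact_mod_cast h))
  have hC2 : padicValNat 2 W.tamagawaProduct = 0 :=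
    padicValNat.eq_zero_of_not_dvd fun h ↦ (Nat.not_even_iff_odd.mpr hT) (even_iff_two_dvd.mpr h)
  have hbudget : padicValNat 2 Wd.tamagawaProduct ≤ 1 := by
    rw [OneBit.padicValNat_two_tamagawaProduct_twin_eq_succ_of_discr_eq_neg_prime W hK hodd hH hℓ₀ hdℓ₀ hneg Cd hCd, hC2]
  rw [hc2, hC2, add_zero, mul_zero, pow_zero, mul_one]
  obtain ⟨hsq1, hsq2⟩ := kolyvaginExclusions_of_odd_of_satisfiesHeegnerHypothesis W hK hodd hH
  have hrk : 1 ≤ W.mordellWeilRank := by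
    rw [(hGZK W (le_of_eq hr)).1, hr]
  exact (finite_and_natCard_primaryComponent_sha_baseChange_two_dvd_pow_of_swappedPair_onHabitat hQ2 W hcm hT v h2v hNv hmult hneg K hK hodd
    h3 hH hsq1 hsq2 hρ Dt β ι d₁ M₀ hndiv hw hrk hSel Cd hCd hbudget).2

end Summit.BirchSwinnertonDyer.BirchSwinnertonDyer.Theorems.GenusExact.TwinSwap.TwinAnnihilation

end
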